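import Summits.ValiantsHypothesis.ValiantsHypothesis.Theorems.PolyaContinuedMonotoneCoverHardIdleSplit

/-!
# Crux `MonotoneCoverHard` (stmt-ValiantsHypothesis-7421), width line — **a PURE fiber has width ≤ 2**
(transfer to the idle-split engine by substitution)

(val-width-7421-p4 g0, 2026-08-28; lane «width ≥ 3 at one level ⇒ non-Pfaffian».)

Setting: a levelled label-bijective Pfaffian cover `(m, E, a)` of `per_n` (labels in `{X j, 0, 1}`,
`per_n = aeval a PM_E`, `E` Pfaffian in the route's symbolic sense, level function `g` on used edges),
a weight-nonzero perfect matching `τ₀` with label permutation `σ₀` (`exists_perm_labels`), a level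
`ℓ₀`, and the set `K` of label-rows that `τ₀` reads at row level `ℓ₀` (so `#K = c_{ℓ₀}` is the WIDTH of
level `ℓ₀`).  The FIBER of `τ₀` over `K` is the set of weight-nonzero perfect matchings whose labels agree
with `τ₀`'s outside `K` (they biject with `Bij(K, σ₀ K)`, i.e. with `S_{#K}`); it is PURE when all its
members read their `K`-labels at level `ℓ₀` as well.

* `aeval_fiberSubst_perPoly` — the FIBER SUBSTITUTION `x_{kl} ↦ x_{kl}` on `K × σ₀K` (renamed to
  `Fin #K × Fin #K`), `x_{k σ₀ k} ↦ 1` for `k ∉ K`, everything else `↦ 0`, maps `per_n` to `per_{#K}`.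
* `false_of_pure_fiber` — **a pure fiber has width `#K ≤ 2`**: substituting turns the cover into a
  cover of `per_{#K}` with the SAME Pfaffian edge set and label shape (but no level function: the edges
  formerly labelled `x_{k σ₀ k}`, `k ∉ K`, now carry `1` and jump a level); purity says every variable
  edge of the new cover leaves row level `ℓ₀`, so `U = rows above ℓ₀`, `P = rows below ℓ₀ ∪ idle rows of
  level ℓ₀` is an idle split and `no_pfaffian_cover_of_idleSplit` gives `#K ≤ 2`.

Consequences (`…RowLevelled.lean`): covers in which the level of a variable edge is determined by its
label-row (or by its label-column) — every cover anyone has written down — have all widths `≤ 2`, hence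
satisfy the crux; the width bet `stub_width` can only fail on covers that read the same label-row at
different levels in different matchings.  VP ≠ VNP is not moved; `MonotoneCoverHard` stays open.
No definitions.
-/

namespace Summit.ValiantsHypothesis.ValiantsHypothesis.Theorems.PolyaContinuedMonotoneCoverHard

-- summit = sub-problem name (single-conjunct summit, D-0017 layout), so the namespace repeats it
set_option linter.dupNamespace false

open scoped Classical
open Finset
open Literature.Computability.AlgebraicComplexity (perPoly)

/-- **The fiber substitution maps `per_n` to `per_{#K}`.**  For `K ⊆ Fin n` and a permutation `σ₀`,
the algebra map `x_{(k,l)} ↦ X (e k, e (σ₀⁻¹ l))` if `k ∈ K` and `σ₀⁻¹ l ∈ K` (`e = K.equivFin`),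
`x_{(k,l)} ↦ 1` if `k ∉ K` and `l = σ₀ k`, `x_{(k,l)} ↦ 0` otherwise, sends the generic `n × n`
permanent to the generic `#K × #K` permanent: only the permutations agreeing with `σ₀` off `K`
survive, and they biject with the permutations of `K`. -/
theorem aeval_fiberSubst_perPoly {n : ℕ} (K : Finset (Fin n)) (σ₀ : Equiv.Perm (Fin n)) :
    MvPolynomial.aeval (fun v : Fin n × Fin n =>
        if hk : v.1 ∈ K then
          (if hl : σ₀.symm v.2 ∈ K then
            (MvPolynomial.X (K.equivFin ⟨v.1, hk⟩, K.equivFin ⟨σ₀.symm v.2, hl⟩) :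
              MvPolynomial (Fin K.card × Fin K.card) ℂ)
          else 0)
        else if v.2 = σ₀ v.1 then 1 else 0)
      (perPoly (Fin n) ℂ) = perPoly (Fin K.card) ℂ := by
  set eK := K.equivFin with heK
  set f : Fin n × Fin n → MvPolynomial (Fin K.card × Fin K.card) ℂ := fun v =>
    if hk : v.1 ∈ K then
      (if hl : σ₀.symm v.2 ∈ K then MvPolynomial.X (eK ⟨v.1, hk⟩, eK ⟨σ₀.symm v.2, hl⟩) else 0)
    else if v.2 = σ₀ v.1 then 1 else 0 with hf
  unfold perPoly
  simp only [Matrix.permanent, map_sum, map_prod, Matrix.mvPolynomialX_apply, MvPolynomial.aeval_X]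
  -- the term of `β` after the reindexing `σ = β * σ₀⁻¹`
  set G : Equiv.Perm (Fin n) → MvPolynomial (Fin K.card × Fin K.card) ℂ :=
    fun β => ∏ k, f (β k, σ₀ k) with hG
  have hA : ∑ σ : Equiv.Perm (Fin n), ∏ i, f (σ i, i) = ∑ β, G β := by
    have h1 : ∀ σ : Equiv.Perm (Fin n), ∏ i, f (σ i, i) = G (Equiv.mulRight σ₀ σ) := by
      intro σ
      rw [hG, Equiv.coe_mulRight]
      simp only
      rw [← Equiv.prod_comp σ₀ (fun i => f (σ i, i))]
      refine Finset.prod_congr rfl fun k _ => ?_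
      rw [Equiv.Perm.mul_apply]
    simp_rw [h1]
    exact Equiv.sum_comp (Equiv.mulRight σ₀) G
  rw [hA]
  -- the embedding of the permutations of `K`
  set ι : Equiv.Perm (Fin K.card) → Equiv.Perm (Fin n) :=
    fun ρ => Equiv.Perm.ofSubtype (eK.symm.permCongr ρ) with hι
  have hιinj : Function.Injective ι := by
    intro ρ ρ' h
    exact eK.symm.permCongr.injective (Equiv.Perm.ofSubtype_injective h)
  have hιK : ∀ ρ k (hk : k ∈ K), ι ρ k = (eK.symm (ρ (eK ⟨k, hk⟩))).1 := by
    intro ρ k hk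
    rw [hι]
    simp only
    rw [Equiv.Perm.ofSubtype_apply_of_mem _ hk, Equiv.permCongr_apply, Equiv.symm_symm]
  have hιnK : ∀ ρ k, k ∉ K → ι ρ k = k := by
    intro ρ k hk
    rw [hι]
    exact Equiv.Perm.ofSubtype_apply_of_not_mem _ hk
  -- value of `G` on the image
  have hGι : ∀ ρ, G (ι ρ) = ∏ i, MvPolynomial.X (ρ i, i) := by
    intro ρ
    rw [hG]
    simp only
    rw [← Finset.prod_mul_prod_compl K (fun k => f (ι ρ k, σ₀ k))]
    have h2 : ∏ k ∈ Kᶜ, f (ι ρ k, σ₀ k) = 1 := by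
      refine Finset.prod_eq_one fun k hk' => ?_
      have hk : k ∉ K := Finset.mem_compl.1 hk'
      rw [hf]
      simp only
      rw [hιnK ρ k hk, dif_neg hk, if_pos rfl]
    rw [h2, mul_one, ← Equiv.prod_comp eK (fun i => MvPolynomial.X (ρ i, i)),
      ← Finset.prod_coe_sort K]
    refine Finset.prod_congr rfl fun k _ => ?_
    have hk : (k : Fin n) ∈ K := k.2
    have h5 : (⟨(k : Fin n), hk⟩ : ↥K) = k := rfl
    have h3 : (ι ρ k : Fin n) ∈ K := by rw [hιK ρ k hk]; exact Subtype.coe_prop _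
    have h4 : (⟨ι ρ k, h3⟩ : ↥K) = eK.symm (ρ (eK k)) := by
      apply Subtype.ext
      show ι ρ k = (eK.symm (ρ (eK k))).1
      rw [hιK ρ k hk]
    rw [hf]
    simp only
    rw [dif_pos h3, Equiv.symm_apply_apply, dif_pos hk, h4, h5, Equiv.apply_symm_apply]
  -- `G` vanishes off the image
  have hG0 : ∀ β, β ∉ Finset.univ.image ι → G β = 0 := by
    intro β hβ
    have hmove : ∃ k, k ∉ K ∧ β k ≠ k := by
      by_contra hall
      push Not at hall
      apply hβ
      have h1 : ∀ x, β x ∈ K ↔ x ∈ K := by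
        intro x
        constructor
        · intro hx
          by_contra hx'
          rw [hall x hx'] at hx
          exact hx' hx
        · intro hx
          by_contra hx'
          have := hall (β x) hx'
          exact hx' (by rw [β.injective this] ; exact hx)
      refine Finset.mem_image.2 ⟨eK.permCongr (β.subtypePerm h1), Finset.mem_univ _, ?_⟩
      rw [hι]
      simp only
      rw [← Equiv.permCongr_symm, Equiv.symm_apply_apply]
      exact Equiv.Perm.ofSubtype_subtypePerm h1 fun x hx => by
        by_contra hxK; exact hx (hall x hxK)
    obtain ⟨k, hk, hβk⟩ := hmove
    rw [hG]
    apply Finset.prod_eq_zero (Finset.mem_univ k)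
    rw [hf]
    simp only
    by_cases hβK : β k ∈ K
    · rw [dif_pos hβK, Equiv.symm_apply_apply, dif_neg hk]
    · rw [dif_neg hβK, if_neg]
      intro h
      exact hβk (σ₀.injective h).symm
  symm
  calc ∑ ρ : Equiv.Perm (Fin K.card), ∏ i, MvPolynomial.X (ρ i, i)
      = ∑ ρ, G (ι ρ) := Finset.sum_congr rfl fun ρ _ => (hGι ρ).symm
    _ = ∑ β ∈ Finset.univ.image ι, G β :=
        (Finset.sum_image fun ρ _ ρ' _ h => hιinj h).symm
    _ = ∑ β, G β := Finset.sum_subset (Finset.subset_univ _) fun β _ hβ => hG0 β hβ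

/-- **A pure fiber has width ≤ 2.**  Let `(m, E, a)` be a cover of `per_n` (labels in
`{X j, 0, 1}`, `per_n = aeval a PM_E`) with Pfaffian `E` (route's symbolic form) and a level function
`g` on its used edges (`hg`); let `τ₀` be a weight-nonzero perfect matching with label permutation `σ₀`
(`hσ₀`, from `exists_perm_labels`), `ℓ₀` a level and `K` the set of label-rows read by `τ₀` at row level
`ℓ₀` (`hK`).  If the fiber of `τ₀` over `K` is PURE (`hpure`: every weight-nonzero perfect matching that
carries the labels `x_{k σ₀ k}`, `k ∉ K`, reads all its labels with label-row in `K` at row level `ℓ₀`),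
then `#K ≤ 2` — stated as `False` under `3 ≤ #K`. -/
theorem false_of_pure_fiber (n m : ℕ) (E : Finset (Fin m × Fin m))
    (a : Fin m × Fin m → MvPolynomial (Fin n × Fin n) ℂ)
    (hsig : ∃ s : Fin m × Fin m → ℂ, (∀ e, s e = 1 ∨ s e = -1) ∧
      (Matrix.of fun i j => if (i, j) ∈ E then MvPolynomial.C (s (i, j)) * MvPolynomial.X (i, j)
          else 0 : Matrix (Fin m) (Fin m) (MvPolynomial (Fin m × Fin m) ℂ)).det =
        (Matrix.of fun i j => if (i, j) ∈ E then MvPolynomial.X (i, j) else 0 :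
          Matrix (Fin m) (Fin m) (MvPolynomial (Fin m × Fin m) ℂ)).permanent)
    (ha : ∀ e, (∃ j, a e = MvPolynomial.X j) ∨ a e = 0 ∨ a e = 1)
    (hper : perPoly (Fin n) ℂ =
      MvPolynomial.aeval a (Matrix.of fun i j => if (i, j) ∈ E then MvPolynomial.X (i, j) else 0 :
          Matrix (Fin m) (Fin m) (MvPolynomial (Fin m × Fin m) ℂ)).permanent)
    (g : Fin m ⊕ Fin m → ℕ)
    (hg : ∀ τ : Equiv.Perm (Fin m), (∀ i, (i, τ i) ∈ E ∧ a (i, τ i) ≠ 0) → ∀ i,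
      ((∃ k, a (i, τ i) = MvPolynomial.X k) → g (Sum.inr (τ i)) = g (Sum.inl i) + 1) ∧
      ((¬ ∃ k, a (i, τ i) = MvPolynomial.X k) → g (Sum.inr (τ i)) = g (Sum.inl i)))
    (τ₀ : Equiv.Perm (Fin m)) (hτ₀ : ∀ i, (i, τ₀ i) ∈ E ∧ a (i, τ₀ i) ≠ 0)
    (σ₀ : Equiv.Perm (Fin n)) (hσ₀ : ∀ i j, a (i, τ₀ i) = MvPolynomial.X j → σ₀ j.1 = j.2)
    (ℓ₀ : ℕ) (K : Finset (Fin n)) (hK3 : 3 ≤ K.card)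
    (hK : ∀ i (k : Fin n), a (i, τ₀ i) = MvPolynomial.X (k, σ₀ k) → (k ∈ K ↔ g (Sum.inl i) = ℓ₀))
    (hpure : ∀ τ : Equiv.Perm (Fin m), (∀ i, (i, τ i) ∈ E ∧ a (i, τ i) ≠ 0) →
      (∀ k, k ∉ K → ∃ i, a (i, τ i) = MvPolynomial.X (k, σ₀ k)) →
      ∀ i (j : Fin n × Fin n), a (i, τ i) = MvPolynomial.X j → j.1 ∈ K → g (Sum.inl i) = ℓ₀) :
    False := by
  set f : Fin n × Fin n → MvPolynomial (Fin K.card × Fin K.card) ℂ := fun v =>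
    if hk : v.1 ∈ K then
      (if hl : σ₀.symm v.2 ∈ K then
        (MvPolynomial.X (K.equivFin ⟨v.1, hk⟩, K.equivFin ⟨σ₀.symm v.2, hl⟩) :
          MvPolynomial (Fin K.card × Fin K.card) ℂ)
      else 0)
    else if v.2 = σ₀ v.1 then 1 else 0 with hf
  set a' : Fin m × Fin m → MvPolynomial (Fin K.card × Fin K.card) ℂ :=
    fun e => MvPolynomial.aeval f (a e) with ha'def
  have ha'ap : ∀ e, a' e = MvPolynomial.aeval f (a e) := fun e => rfl
  have hX0 : ∀ j, (MvPolynomial.X j : MvPolynomial (Fin K.card × Fin K.card) ℂ) ≠ 0 :=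
    fun j => MvPolynomial.X_ne_zero j
  have hX1 : ∀ j, (MvPolynomial.X j : MvPolynomial (Fin K.card × Fin K.card) ℂ) ≠ 1 := by
    intro j h
    have h1 := congrArg MvPolynomial.totalDegree h
    rw [MvPolynomial.totalDegree_X, MvPolynomial.totalDegree_one] at h1
    exact one_ne_zero h1
  -- the four values of `f`
  have hfX : ∀ v : Fin n × Fin n, ∀ (hk : v.1 ∈ K) (hl : σ₀.symm v.2 ∈ K),
      f v = MvPolynomial.X (K.equivFin ⟨v.1, hk⟩, K.equivFin ⟨σ₀.symm v.2, hl⟩) := by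
    intro v hk hl
    rw [hf]
    simp only
    rw [dif_pos hk, dif_pos hl]
  have hf0 : ∀ v : Fin n × Fin n, v.1 ∈ K → σ₀.symm v.2 ∉ K → f v = 0 := by
    intro v hk hl
    rw [hf]
    simp only
    rw [dif_pos hk, dif_neg hl]
  have hf1 : ∀ v : Fin n × Fin n, v.1 ∉ K → v.2 = σ₀ v.1 → f v = 1 := by
    intro v hk hl
    rw [hf]
    simp only
    rw [dif_neg hk, if_pos hl]
  have hf0' : ∀ v : Fin n × Fin n, v.1 ∉ K → v.2 ≠ σ₀ v.1 → f v = 0 := by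
    intro v hk hl
    rw [hf]
    simp only
    rw [dif_neg hk, if_neg hl]
  have ha'X : ∀ e v, a e = MvPolynomial.X v → a' e = f v := by
    intro e v hv
    rw [ha'ap, hv, MvPolynomial.aeval_X]
  -- label shape of the substituted cover
  have ha' : ∀ e, (∃ j, a' e = MvPolynomial.X j) ∨ a' e = 0 ∨ a' e = 1 := by
    intro e
    rcases ha e with ⟨v, hv⟩ | h | h
    · rw [ha'X e v hv]
      by_cases hk : v.1 ∈ K
      · by_cases hl : σ₀.symm v.2 ∈ K
        · exact Or.inl ⟨_, hfX v hk hl⟩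
        · exact Or.inr (Or.inl (hf0 v hk hl))
      · by_cases hl : v.2 = σ₀ v.1
        · exact Or.inr (Or.inr (hf1 v hk hl))
        · exact Or.inr (Or.inl (hf0' v hk hl))
    · right; left
      rw [ha'ap, h, map_zero]
    · right; right
      rw [ha'ap, h, map_one]
  -- F1: a new variable label comes from an old variable label with label-row in `K`
  have hF1 : ∀ e j', a' e = MvPolynomial.X j' → ∃ v, a e = MvPolynomial.X v ∧ v.1 ∈ K := by
    intro e j' h
    rcases ha e with ⟨v, hv⟩ | h0 | h1
    · refine ⟨v, hv, ?_⟩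
      by_contra hk
      rw [ha'X e v hv] at h
      by_cases hl : v.2 = σ₀ v.1
      · rw [hf1 v hk hl] at h
        exact hX1 j' h.symm
      · rw [hf0' v hk hl] at h
        exact hX0 j' h.symm
    · exfalso
      rw [ha'ap, h0, map_zero] at h
      exact hX0 j' h.symm
    · exfalso
      rw [ha'ap, h1, map_one] at h
      exact hX1 j' h.symm
  -- F2: new-nonzero labels are old-nonzero
  have hF2 : ∀ e, a' e ≠ 0 → a e ≠ 0 := by
    intro e h h0
    apply h
    rw [ha'ap, h0, map_zero]
  -- F3: a new-good matching is old-good and carries the labels `x_{k σ₀ k}`, `k ∉ K`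
  have hF3 : ∀ τ : Equiv.Perm (Fin m), (∀ i, (i, τ i) ∈ E ∧ a' (i, τ i) ≠ 0) →
      (∀ i, (i, τ i) ∈ E ∧ a (i, τ i) ≠ 0) ∧
      (∀ k, k ∉ K → ∃ i, a (i, τ i) = MvPolynomial.X (k, σ₀ k)) := by
    intro τ hτ
    have hτold : ∀ i, (i, τ i) ∈ E ∧ a (i, τ i) ≠ 0 := fun i => ⟨(hτ i).1, hF2 _ (hτ i).2⟩
    refine ⟨hτold, fun k hk => ?_⟩
    obtain ⟨σ, -, hσ2⟩ := exists_perm_labels E a ha hper τ hτold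
    obtain ⟨i, hi, -⟩ := hσ2 k
    have hne := (hτ i).2
    rw [ha'X _ _ hi] at hne
    by_cases hl : σ k = σ₀ k
    · exact ⟨i, by rw [hi, hl]⟩
    · exact absurd (hf0' (k, σ k) hk hl) hne
  -- F4 (key): every used variable edge of the substituted cover leaves row level `ℓ₀` …
  have hF4 : ∀ i j, (∃ τ : Equiv.Perm (Fin m), (∀ k, (k, τ k) ∈ E ∧ a' (k, τ k) ≠ 0) ∧ τ i = j) →
      (∃ k, a' (i, j) = MvPolynomial.X k) → g (Sum.inl i) = ℓ₀ := by
    rintro i j ⟨τ, hτ, rfl⟩ ⟨k', hk'⟩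
    obtain ⟨hτold, hagree⟩ := hF3 τ hτ
    obtain ⟨v, hv, hvK⟩ := hF1 _ _ hk'
    exact hpure τ hτold hagree i v hv hvK
  -- … and enters column level `ℓ₀ + 1`
  have hF4' : ∀ i j, (∃ τ : Equiv.Perm (Fin m), (∀ k, (k, τ k) ∈ E ∧ a' (k, τ k) ≠ 0) ∧ τ i = j) →
      (∃ k, a' (i, j) = MvPolynomial.X k) → g (Sum.inr j) = ℓ₀ + 1 := by
    rintro i j ⟨τ, hτ, rfl⟩ ⟨k', hk'⟩
    obtain ⟨hτold, hagree⟩ := hF3 τ hτ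
    obtain ⟨v, hv, hvK⟩ := hF1 _ _ hk'
    rw [(hg τ hτold i).1 ⟨v, hv⟩, hpure τ hτold hagree i v hv hvK]
  -- F5: `τ₀` is a weight-nonzero perfect matching of the substituted cover
  have hτ₀' : ∀ i, (i, τ₀ i) ∈ E ∧ a' (i, τ₀ i) ≠ 0 := by
    intro i
    refine ⟨(hτ₀ i).1, ?_⟩
    rcases ha (i, τ₀ i) with ⟨v, hv⟩ | h0 | h1
    · have hv2 : v.2 = σ₀ v.1 := (hσ₀ i v hv).symm
      rw [ha'X _ _ hv]
      by_cases hk : v.1 ∈ K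
      · have hl : σ₀.symm v.2 ∈ K := by rw [hv2, Equiv.symm_apply_apply]; exact hk
        rw [hfX v hk hl]
        exact hX0 _
      · rw [hf1 v hk hv2]
        exact one_ne_zero
    · exact absurd h0 (hτ₀ i).2
    · rw [ha'ap, h1, map_one]
      exact one_ne_zero
  -- F6: a level-`ℓ₀` row whose `τ₀`-edge is not variable in the substituted cover is an idle row
  have hF6 : ∀ i, g (Sum.inl i) = ℓ₀ → (¬ ∃ k, a' (i, τ₀ i) = MvPolynomial.X k) →
      g (Sum.inr (τ₀ i)) = ℓ₀ := by
    intro i hi hnv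
    have hflat : ¬ ∃ k, a (i, τ₀ i) = MvPolynomial.X k := by
      rintro ⟨v, hv⟩
      have hv2 : v.2 = σ₀ v.1 := (hσ₀ i v hv).symm
      by_cases hk : v.1 ∈ K
      · apply hnv
        have hl : σ₀.symm v.2 ∈ K := by rw [hv2, Equiv.symm_apply_apply]; exact hk
        exact ⟨_, by rw [ha'X _ _ hv, hfX v hk hl]⟩
      · have hv' : a (i, τ₀ i) = MvPolynomial.X (v.1, σ₀ v.1) := by
          rw [hv, ← hv2]
        exact hk ((hK i v.1 hv').2 hi)
    rw [(hg τ₀ hτ₀ i).2 hflat, hi]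
  -- the substituted cover computes `per_{#K}`
  have hper' : perPoly (Fin K.card) ℂ =
      MvPolynomial.aeval a' (Matrix.of fun i j => if (i, j) ∈ E then MvPolynomial.X (i, j) else 0 :
          Matrix (Fin m) (Fin m) (MvPolynomial (Fin m × Fin m) ℂ)).permanent := by
    rw [← aeval_fiberSubst_perPoly K σ₀, hper, MvPolynomial.comp_aeval_apply]
  -- apply the idle-split engine with `U` = rows above `ℓ₀`, `P` = rows below `ℓ₀` ∪ idle rows at `ℓ₀`
  refine no_pfaffian_cover_of_idleSplit K.card m hK3 E a' hsig ha' hper' τ₀ hτ₀'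
    (fun i => ℓ₀ < g (Sum.inl i))
    (fun i => g (Sum.inl i) < ℓ₀ ∨ (g (Sum.inl i) = ℓ₀ ∧ ¬ ∃ k, a' (i, τ₀ i) = MvPolynomial.X k))
    ?_ ?_ ?_ ?_ ?_ ?_
  · -- the remaining rows are the variable `τ₀`-rows
    intro i hU hP
    by_contra hnv
    have h1 : g (Sum.inl i) = ℓ₀ := by
      by_contra h2
      rcases Nat.lt_or_gt_of_ne h2 with h3 | h3
      · exact hP (Or.inl h3)
      · exact hU h3
    exact hP (Or.inr ⟨h1, hnv⟩)
  · -- `U`-rows have non-variable `τ₀`-edges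
    intro i hU hv
    have := hF4 i (τ₀ i) ⟨τ₀, hτ₀', rfl⟩ hv
    omega
  · -- `P`-rows have non-variable `τ₀`-edges
    intro i hP hv
    rcases hP with h | ⟨-, h⟩
    · have := hF4 i (τ₀ i) ⟨τ₀, hτ₀', rfl⟩ hv
      omega
    · exact h hv
  · -- `U`-rows emit no used variable edge
    intro i j hU hu hv
    have := hF4 i j hu hv
    omega
  · -- no used variable edge from outside `U` into the `τ₀`-columns of `P`
    intro i i' _ hP hu hv
    have h1 := hF4' i (τ₀ i') hu hv
    rcases hP with h | ⟨h, hnv⟩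
    · have h2 := hg τ₀ hτ₀ i'
      by_cases hvi : ∃ k, a (i', τ₀ i') = MvPolynomial.X k
      · have := h2.1 hvi
        omega
      · have := h2.2 hvi
        omega
    · have := hF6 i' h hnv
      omega
  · -- no used edge from `U` into the `τ₀`-columns of `P`
    intro i i' hU hP _ hu
    obtain ⟨τ, hτ, hτi⟩ := hu
    obtain ⟨hτold, -⟩ := hF3 τ hτ
    have h2 := hg τ hτold i
    rw [hτi] at h2
    have hge : ℓ₀ + 1 ≤ g (Sum.inr (τ₀ i')) := by
      by_cases hvi : ∃ k, a (i, τ₀ i') = MvPolynomial.X k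
      · have := h2.1 hvi
        omega
      · have := h2.2 hvi
        omega
    rcases hP with h | ⟨h, hnv⟩
    · have h3 := hg τ₀ hτ₀ i'
      by_cases hvi : ∃ k, a (i', τ₀ i') = MvPolynomial.X k
      · have := h3.1 hvi
        omega
      · have := h3.2 hvi
        omega
    · have := hF6 i' h hnv
      omega

end Summit.ValiantsHypothesis.ValiantsHypothesis.Theorems.PolyaContinuedMonotoneCoverHard
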